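import Summits.BirchSwinnertonDyer.BirchSwinnertonDyer.Theorems.SignedLowerHalvesSmallImageLowerHalfBothSignsLambdaLowerThreeNsDoor
import Summits.BirchSwinnertonDyer.BirchSwinnertonDyer.Theorems.SignedLowerHalvesSmallImageLowerHalfBothSignsLambdaParityMuFree
import Summits.BirchSwinnertonDyer.BirchSwinnertonDyer.Theorems.SignedLowerHalvesKobayashiLowerHalfLargeImageLambdaTwoStratum
import Summits.BirchSwinnertonDyer.BirchSwinnertonDyer.Theorems.SchneiderAtThreeInvolOrderParity
import Literature.NumberTheory.EllipticCurves.BDKim2013.SignedCharValueRankZero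
import Literature.NumberTheory.EllipticCurves.Kim2008.AlgebraicFunctionalEquationSigned
import Literature.NumberTheory.EllipticCurves.BSDSelmerParityDokchitserProofs
import HarnessLib

/-!
# Route `SignedLowerHalves` (K3), child crux L `SmallImageLowerHalfBothSigns` (item stmt-BirchSwinnertonDyer-23599),
# line `birth_acns`, stub `stub_lambdaLowerThree_ns` (= retired item 23118 `SmallImageLambdaLowerAtThree`, VERBATIM):
# what the ALGEBRAIC FUNCTIONAL EQUATION of `Sel^ε(E/ℚ_∞)` gives for the Eisenstein λ-inequality — rank-`0`
# ALGEBRAIC λ-PARITY, the `λ = 2` / `T = 0` SHADOW at small image, and the DEFECT-EVENNESS door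
# (cell `bsd-ssimc`, width seat `bsd-line-slh-p3-w3` gen 4; ROUTE-INDEPENDENT helper `--supports 23599`; no `Theses` import)

HONEST FRAMING: CALIBRATION / SUPPORT ONLY. The stub (the Eisenstein λ-inequality `λ(L_3^ε) ≤ λ(ξ^ε)` at every
small-image `p = 3` X7 pair) is OPEN MATHEMATICS (w3 g0 `stub-blocked`; g3: residue = pairs with
`corank + 2 ≤ λ(L_3^ε)`); nothing here closes it; BSD / child L / the stub are NOT proved. Every theorem is
CONDITIONAL on DISPLAYED binders: published named facts (Kobayashi 2003 Thm. 1.2 `h12` / Thm. 4.1 rational display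
`h41`, B. D. Kim 2013 Cor. 3.15 `hK13`, the `p`-parity theorem `hpar`) and ONE per-datum algebraic hypothesis
`hAFE : ι(Char X^ε) = Char X^ε` — VERBATIM the body of B. D. Kim 2008 Thm. 3.12 at the datum, which the tree's named
fact `Kim2008.thm312_signedSelmerDual_charIdeal_map_invol` supplies for `p > 3` ONLY (printed scope, MRL 15 (2008)
p. 83); at `p = 3`, `a_3 = 0` it is the tree's standing TYPING REQUEST (module docstring of
`…LargeImageLambdaTwoStratumOddPrime.lean`; Lei–Ponsinet 2017 Thm. 1/2 are printed for `p` odd on the Büyükboduk–Lei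
multi-signed Selmer groups, which "generalize Kobayashi's plus and minus Selmer groups" — not verbatim on the tree's
objects). THEOREMS ONLY; no definition, no named fact, no `sorry`.

## What is proved (per datum / per pair and sign; odd good `p`, `a_p = 0`, ANY image, ANY `μ` unless displayed)

* §1 rank-`0` ALGEBRAIC λ-PARITY: `ι(Char X^ε) = Char X^ε` ∧ `ξ^ε(0) ≠ 0` ⟹ `λ(ξ^ε)` EVEN (tree lemma
  `order_mod_two_eq_lambdaInvariant_of_map_invol_eq`: `ord_T ξ ≡ λ (mod 2)`, read at `ord_T ξ = 0`); with `h12`, `hK13`: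
  `Sel_{p^∞}(E/ℚ)` finite ⟹ `λ(ξ^ε)` even — the algebraic twin of g3's analytic `even_lam_iff_even_analyticRank`.
* §2 the `λ = 2` / `T = 0` SHADOW: `Sel` finite ∧ `p ∣ Tam(E)·#Sel_{p^∞}(E/ℚ)` ∧ `μ(ξ^ε) = 0` ∧ `hAFE` ⟹ `λ(ξ^ε) ≥ 2`
  (slh-p1-w6's `λ = 2` closer with its only use of `ρ̄` onto — integral Kato ⟹ `μ(ξ) = 0` — replaced by the
  displayed `μ(ξ^ε) = 0`, crux M's currency); hence `λ(L_p^ε) ≤ 2` ⟹ the Eisenstein λ-inequality at the datum and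
  the stub's `p`-inverted λ-shape (w3 g0's λ-door). NECESSITY: at a `Sel`-finite pair, `λ(L) ≥ 1` and the
  λ-inequality force `p ∣ Tam(E)·#Sel` (the rank-`0` converse divisibility at `T = 0`).
* §3 rank-`0` DEFECT EVENNESS `λ(L_p^ε) − λ(ξ^ε) ∈ 2ℕ` (analytic side: g3's μ-free `w(E) = (−1)^{λ(L_p^ε)}` + `p`-parity
  at corank `0`; algebraic side: §1) ⟹ the door widened on the algebraic side: `λ(L_p^ε) ≤ λ(ξ^ε) + 1` suffices.
* §4 sanity: at `p > 3` the displayed `hAFE` is Kim's named fact (any image).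

READING for the LEAD (numbers, not adjectives; W-plan-12 v5 window): 96 of the 100 small-image `p = 3` X7 pairs have
rank `0`; there, modulo AFE(3) + print, the λ-stub at sign `ε` ⟸ «`λ(L_3^ε) ≤ λ(ξ^ε) + 1`», and on the `λ(L_3^ε) = 2`
sub-stratum ⟸ «`3 ∣ Tam(E)·#Sel_{3^∞}(E/ℚ)`» (the stub's own NECESSARY `T = 0` shadow, decidable per pair) ∧
«`μ(X^ε) = 0`» (crux M's body at that sign; PROVED at `p = 3` modulo print for ONE sign,
`SmallImageMuControl.smallImageMuZeroOneSign_three_of_facts`). Class-wide the stub stays open: the functional equation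
yields parity / `ord_T` information only (barrier `PAdicFunctionalEquationParity`).

References: [KimBD2008MRL] Thm. 3.12 (p. 93), §1 p. 83; [LeiPonsinet2017] §1, Thm. 1, Thm. 2; [Kobayashi2003] Thm. 1.2,
Thm. 4.1 (p. 8), Conjecture (p. 2); [BDKim2013] Cor. 3.15 (p. 199); [DokchitserDokchitserAnnals2010] Thm. 1.4, Cor. 4.20;
[Sprung2017] Cor. 4.14; [GreenbergLNM1716] Thm. 1.14, Prop. 3.10, Lemma 4.2, §5 p. 181; [GreenbergVatsal2000] p. 4;
[Washington1997] §7.1, §13.2.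
-/

set_option autoImplicit false
-- D-0017: single-problem summit, the namespace repeats the problem name by design.
set_option linter.dupNamespace false

noncomputable section

open scoped Classical MatrixGroups ModularForm

open CongruenceSubgroup PowerSeries WeierstrassCurve Field Literature.NumberTheory.EllipticCurves
  Literature.NumberTheory.EllipticCurves.ModularForms
  Literature.NumberTheory.EllipticCurves.Rank1Residual
  Literature.NumberTheory.EllipticCurves.Kobayashi2003 ZpExtension
  Literature.NumberTheory.EllipticCurves.Rank1Residual.Typed
  Summit.BirchSwinnertonDyer.Rank1Residual
  Summit.BirchSwinnertonDyer.Rank1Residual.X1.MuLambda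
  Summit.BirchSwinnertonDyer.Rank1Residual.Supersingular

namespace Summit.BirchSwinnertonDyer.BirchSwinnertonDyer.Theorems.SmallImageLambdaLowerThreeNsAFE

open SmallImageLambdaLowerThreeNsDoor SmallImageLambdaParityMuFree LargeImageLambdaTwoStratum

/-! ## §1. Rank-`0` algebraic λ-parity from the algebraic functional equation -/

section Parity

variable {p : ℕ} [Fact p.Prime] {W : WeierstrassCurve ℚ} [W.IsElliptic] [W.IsGloballyMinimal]
  {κ : ZpExtension ℚ p} {γ : absoluteGaloisGroup ℚ} {ε : ℤˣ}

omit [W.IsElliptic] [W.IsGloballyMinimal] in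
/-- **`ι`-stability of `Char X^ε` and `ξ(0) ≠ 0` force `λ(ξ)` EVEN** (pure `Λ`-algebra on a dual datum `D` of
`Sel^ε(E/ℚ_∞)`, `p ≠ 2`; `X^ε` f.g. torsion, `Char X^ε = (ξ)` fixed by `ι : T ↦ (1+T)⁻¹ − 1`): the tree's
`order_mod_two_eq_lambdaInvariant_of_map_invol_eq` (`ord_T ξ ≡ λ(X^ε) (mod 2)`: the zeros off `T = 0` pair up
`a ↔ (1+a)⁻¹ − 1`) read at `ord_T ξ = 0`. [cite: GreenbergLNM1716, Thm. 1.14 and Prop. 3.10] [cite: Washington1997, §7.1, §13.2] -/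
theorem even_lam_charGen_of_afe_of_constantCoeff_ne_zero (hp : p ≠ 2) (D : SignedSelmerDualData W κ γ ε)
    [Module.Finite (IwasawaAlgebra p) D.X] (hX : Module.IsTorsion (IwasawaAlgebra p) D.X)
    {ξ : IwasawaAlgebra p} (hξ : D.charIdeal = Ideal.span {ξ})
    (hAFE : Ideal.map (IwasawaAlgebra.invol p) D.charIdeal = D.charIdeal)
    (h0 : constantCoeff ξ ≠ 0) : Even (lam ξ) := by
  have hξ0 : ξ ≠ 0 := ne_zero_of_charIdeal_eq_span D hξ
  have hchar : Literature.NumberTheory.EllipticCurves.Module.charIdeal (IwasawaAlgebra p) D.X = Ideal.span {ξ} := hξ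
  have hmap : Ideal.map (IwasawaAlgebra.invol p)
      (Literature.NumberTheory.EllipticCurves.Module.charIdeal (IwasawaAlgebra p) D.X) =
      Literature.NumberTheory.EllipticCurves.Module.charIdeal (IwasawaAlgebra p) D.X := hAFE
  obtain ⟨n, hn, hmod⟩ := order_mod_two_eq_lambdaInvariant_of_map_invol_eq hp D.X hX hξ0 hchar hmap
  -- `ord_T ξ = 0` since `ξ(0) ≠ 0`
  have hord : ξ.order = (0 : ℕ) := by
    rw [order_eq_nat]
    exact ⟨by rwa [coeff_zero_eq_constantCoeff_apply], fun i hi ↦ absurd hi (Nat.not_lt_zero i)⟩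
  have hn0 : n = 0 := by
    have e : ((n : ℕ) : ℕ∞) = ((0 : ℕ) : ℕ∞) := by rw [← hn, hord]
    exact_mod_cast e
  rw [hn0, Nat.zero_mod] at hmod
  have hlam : lam ξ = lambdaInvariant p D.X := X1.ParitySqueeze.lam_generator_eq_lambdaInvariant D.X hX hξ0 hchar
  rw [hlam, Nat.even_iff]
  exact hmod.symm

/-- **Rank-`0` ALGEBRAIC λ-PARITY: `Sel_{p^∞}(E/ℚ)` finite and the functional equation at the datum force `λ(ξ^ε)`
EVEN.** Odd good `p`, `a_p = 0`, cyclotomic frame, dual datum `D` of `Sel^ε(E/ℚ_∞)` with generator `ξ`, ANY image, ANY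
`μ`; granted Kobayashi Thm. 1.2 (`h12`) and B. D. Kim 2013 Cor. 3.15 (`hK13`: `ξ(0) ∼ Tam·#Sel ≠ 0`); `hAFE` = the body
of Kim 2008 Thm. 3.12 AT THE DATUM (named fact for `p > 3`; hypothesis at `p = 3`).
[cite: KimBD2008MRL, Thm. 3.12 (p. 93) and §1 p. 83] [cite: BDKim2013, Cor. 3.15 (p. 199)] [cite: Kobayashi2003, Thm. 1.2 (p. 2)] -/
theorem even_lam_charGen_of_afe_of_finite (h12 : Kobayashi2003.thm12_signedSelmerDual_finite_torsion)
    (hK13 : BDKim2013.cor315_signedCharValue_rankZero) (hp : p ≠ 2) (hgood : W.HasGoodReductionAtPrime p)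
    (hap : W.frobeniusTrace p = 0) (hκ : κ.IsCyclotomic) (hγ : κ.IsTopGenerator γ)
    (D : SignedSelmerDualData W κ γ ε) {ξ : IwasawaAlgebra p} (hξ : D.charIdeal = Ideal.span {ξ})
    (hAFE : Ideal.map (IwasawaAlgebra.invol p) D.charIdeal = D.charIdeal)
    (hfin : Finite (W.selmerGroupPInfty p)) : Even (lam ξ) := by
  haveI : Module.Finite (IwasawaAlgebra p) D.X := h12.moduleFinite hp hgood hap hκ hγ D
  have hX : Module.IsTorsion (IwasawaAlgebra p) D.X := h12.isTorsion hp hgood hap hκ hγ D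
  exact even_lam_charGen_of_afe_of_constantCoeff_ne_zero hp D hX hξ hAFE
    (BDKim2013.cor315_signedCharValue_rankZero.constantCoeff_ne_zero hK13 hp hgood hap hκ hγ D hX hξ hfin)

end Parity

/-! ## §2. The `λ = 2` / `T = 0` shadow at small image -/

section Shadow

variable {p : ℕ} [Fact p.Prime] {W : WeierstrassCurve ℚ} [W.IsElliptic] [W.IsGloballyMinimal]
  {κ : ZpExtension ℚ p} {γ : absoluteGaloisGroup ℚ} {ε : ℤˣ}

/-- **Even and non-zero ⟹ at least two.** Same frame as `even_lam_charGen_of_afe_of_finite`; if moreover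
`λ(ξ^ε) ≠ 0` (the signed Selmer group over `ℚ_∞` has positive `ℤ_p`-corank), then `λ(ξ^ε) ≥ 2`.
[cite: KimBD2008MRL, Thm. 3.12 (p. 93)] [cite: BDKim2013, Cor. 3.15 (p. 199)] -/
theorem two_le_lam_charGen_of_afe_of_lam_ne_zero (h12 : Kobayashi2003.thm12_signedSelmerDual_finite_torsion)
    (hK13 : BDKim2013.cor315_signedCharValue_rankZero) (hp : p ≠ 2) (hgood : W.HasGoodReductionAtPrime p)
    (hap : W.frobeniusTrace p = 0) (hκ : κ.IsCyclotomic) (hγ : κ.IsTopGenerator γ)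
    (D : SignedSelmerDualData W κ γ ε) {ξ : IwasawaAlgebra p} (hξ : D.charIdeal = Ideal.span {ξ})
    (hAFE : Ideal.map (IwasawaAlgebra.invol p) D.charIdeal = D.charIdeal)
    (hfin : Finite (W.selmerGroupPInfty p)) (hlam0 : lam ξ ≠ 0) : 2 ≤ lam ξ := by
  obtain ⟨k, hk⟩ := even_lam_charGen_of_afe_of_finite h12 hK13 hp hgood hap hκ hγ D hξ hAFE hfin
  omega

/-- **`p ∣ ξ^ε(0)`** from B. D. Kim 2013 Cor. 3.15 and `p ∣ Tam(E)·#Sel_{p^∞}(E/ℚ)` (`Sel` finite; the bookkeeping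
of slh-p1-w6's closer, isolated). [cite: BDKim2013, Cor. 3.15 (p. 199)] -/
theorem dvd_constantCoeff_charGen_of_dvd (h12 : Kobayashi2003.thm12_signedSelmerDual_finite_torsion)
    (hK13 : BDKim2013.cor315_signedCharValue_rankZero) (hp : p ≠ 2) (hgood : W.HasGoodReductionAtPrime p)
    (hap : W.frobeniusTrace p = 0) (hκ : κ.IsCyclotomic) (hγ : κ.IsTopGenerator γ)
    (D : SignedSelmerDualData W κ γ ε) {ξ : IwasawaAlgebra p} (hξ : D.charIdeal = Ideal.span {ξ})
    (hfin : Finite (W.selmerGroupPInfty p))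
    (hdvd : p ∣ W.tamagawaProduct * Nat.card (W.selmerGroupPInfty p)) :
    (p : ℤ_[p]) ∣ constantCoeff ξ := by
  have hpP : p.Prime := Fact.out
  haveI : Module.Finite (IwasawaAlgebra p) D.X := h12.moduleFinite hp hgood hap hκ hγ D
  have hX : Module.IsTorsion (IwasawaAlgebra p) D.X := h12.isTorsion hp hgood hap hκ hγ D
  obtain ⟨u, hu⟩ := hK13 W p hp hgood hap κ γ hκ hγ ε D hX ξ hξ hfin
  have hu' : constantCoeff ξ = (u : ℤ_[p]) * (p : ℤ_[p]) ^ padicValNat p W.tamagawaProduct *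
      (Nat.card (W.selmerGroupPInfty p) : ℤ_[p]) := by
    refine PadicInt.ext ?_
    push_cast
    exact hu
  rw [hu']
  rcases hpP.dvd_mul.mp hdvd with ht | hc
  · have ht1 : 1 ≤ padicValNat p W.tamagawaProduct :=
      one_le_padicValNat_of_dvd (W.tamagawaProduct_pos').ne' ht
    exact Dvd.dvd.mul_right (Dvd.dvd.mul_left (dvd_pow_self _ (by omega)) _) _
  · exact Dvd.dvd.mul_left (Nat.cast_dvd_cast hc) _

/-- **The `λ = 2` / `T = 0` SHADOW at small image: `λ(ξ^ε) ≥ 2`.** Same frame; granted `h12`, `hK13`, `hAFE`: if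
`Sel_{p^∞}(E/ℚ)` is finite, `p ∣ ∏_ℓ c_ℓ · #Sel_{p^∞}(E/ℚ)` and `μ(ξ^ε) = 0`, then `λ(ξ^ε) ≥ 2` (`p ∣ ξ(0)`, so `λ(ξ) = 0`
would make `ξ` a unit; then §1). The algebraic core of slh-p1-w6's `kobayashiMainConjecture_of_lam_eq_two_of_finite_of_dvd_of_afe`
with its only use of `ρ̄` onto (integral Kato ⟹ `μ(ξ) = 0`) REPLACED by the displayed `μ(ξ^ε) = 0`.
[cite: KimBD2008MRL, Thm. 3.12 (p. 93)] [cite: BDKim2013, Cor. 3.15 (p. 199)] [cite: Kobayashi2003, Thm. 1.2 (p. 2)] [cite: Washington1997, §7.1] -/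
theorem two_le_lam_charGen_of_afe_of_dvd_of_mu_eq_zero
    (h12 : Kobayashi2003.thm12_signedSelmerDual_finite_torsion)
    (hK13 : BDKim2013.cor315_signedCharValue_rankZero) (hp : p ≠ 2) (hgood : W.HasGoodReductionAtPrime p)
    (hap : W.frobeniusTrace p = 0) (hκ : κ.IsCyclotomic) (hγ : κ.IsTopGenerator γ)
    (D : SignedSelmerDualData W κ γ ε) {ξ : IwasawaAlgebra p} (hξ : D.charIdeal = Ideal.span {ξ})
    (hAFE : Ideal.map (IwasawaAlgebra.invol p) D.charIdeal = D.charIdeal)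
    (hfin : Finite (W.selmerGroupPInfty p))
    (hdvd : p ∣ W.tamagawaProduct * Nat.card (W.selmerGroupPInfty p)) (hμ : mu ξ = 0) : 2 ≤ lam ξ := by
  refine two_le_lam_charGen_of_afe_of_lam_ne_zero h12 hK13 hp hgood hap hκ hγ D hξ hAFE hfin fun hl ↦ ?_
  have hξ0 : ξ ≠ 0 := ne_zero_of_charIdeal_eq_span D hξ
  have hunit : IsUnit ξ := (isUnit_iff_mu_eq_zero_and_lam_eq_zero ξ).mpr ⟨hξ0, hμ, hl⟩
  exact not_isUnit_of_dvd (dvd_constantCoeff_charGen_of_dvd h12 hK13 hp hgood hap hκ hγ D hξ hfin hdvd)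
    (PowerSeries.isUnit_iff_constantCoeff.mp hunit)

/-- **The Eisenstein λ-inequality at the datum on the `λ(L_p^ε) ≤ 2` stratum, ANY image** (no `h41` needed): under
the hypotheses of `two_le_lam_charGen_of_afe_of_dvd_of_mu_eq_zero`, for the newform's Pollack pair — indeed for ANY
`L ∈ Λ` with `lam L ≤ 2` — `lam L ≤ lam ξ^ε`. At a rank-`0` pair with certificate `λ(L_p^ε) = 2` this is the content
of `stub_lambdaLowerThree_ns` at that pair and sign (w3 g0 `smallImageLambdaLowerAtThree_iff_lamLe`).
[cite: KimBD2008MRL, Thm. 3.12 (p. 93)] [cite: BDKim2013, Cor. 3.15 (p. 199)] [cite: Kobayashi2003, Thm. 1.2 and Conjecture (p. 2)] -/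
theorem lam_le_lam_charGen_of_afe_of_lam_le_two
    (h12 : Kobayashi2003.thm12_signedSelmerDual_finite_torsion)
    (hK13 : BDKim2013.cor315_signedCharValue_rankZero) (hp : p ≠ 2) (hgood : W.HasGoodReductionAtPrime p)
    (hap : W.frobeniusTrace p = 0) (hκ : κ.IsCyclotomic) (hγ : κ.IsTopGenerator γ)
    (D : SignedSelmerDualData W κ γ ε) {ξ : IwasawaAlgebra p} (hξ : D.charIdeal = Ideal.span {ξ})
    (hAFE : Ideal.map (IwasawaAlgebra.invol p) D.charIdeal = D.charIdeal)
    (hfin : Finite (W.selmerGroupPInfty p))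
    (hdvd : p ∣ W.tamagawaProduct * Nat.card (W.selmerGroupPInfty p)) (hμ : mu ξ = 0)
    {L : IwasawaAlgebra p} (hL2 : lam L ≤ 2) : lam L ≤ lam ξ :=
  hL2.trans (two_le_lam_charGen_of_afe_of_dvd_of_mu_eq_zero h12 hK13 hp hgood hap hκ hγ D hξ hAFE hfin hdvd hμ)

/-- **The stub's `p`-inverted λ-shape at every dual datum of sign `ε` on the `λ(L_p^ε) ≤ 2` stratum, ANY image**:
cyclotomic frame, newform `f` of level `N_E`, idle period ratio `ϖ`, Pollack pair with `λ(L_p^ε) ≤ 2`; granted `h12`,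
`h41` (rational display, for w3 g0's λ-door `lambdaShape_iff_forall_lam_le`), `hK13`; per pair `Sel` finite and
`p ∣ ∏ c_ℓ · #Sel`; per sign `μ(ξ^ε) = 0` and the functional equation at every datum.
[cite: Kobayashi2003, Thm. 1.2, Thm. 4.1 (p. 8) and Conjecture (p. 2)] [cite: KimBD2008MRL, Thm. 3.12 (p. 93)] [cite: BDKim2013, Cor. 3.15 (p. 199)] -/
theorem lambdaShape_of_afe_of_lam_le_two (h12 : Kobayashi2003.thm12_signedSelmerDual_finite_torsion)
    (h41 : Kobayashi2003.thm41_signedCharIdeal_divisibility) (hK13 : BDKim2013.cor315_signedCharValue_rankZero)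
    (hp : p ≠ 2) (hgood : W.HasGoodReductionAtPrime p) (hap : W.frobeniusTrace p = 0) (hκ : κ.IsCyclotomic)
    (hγ : κ.IsTopGenerator γ) (hγ' : IsCyclotomicVariable p γ) [NeZero (W.conductorNorm ℤ)]
    {f : CuspForm (Gamma0 (W.conductorNorm ℤ)) 2} (hf : IsNewformOf W f) {ϖ : ℚ}
    (hϖ : (ϖ : ℝ) * W.realPeriodRat = plusPeriod f) {Lplus Lminus : IwasawaAlgebra p}
    (hPP : IsPollackPair f p Lplus Lminus) (hL2 : lam (kobayashiL ε Lplus Lminus) ≤ 2)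
    (hfin : Finite (W.selmerGroupPInfty p)) (hdvd : p ∣ W.tamagawaProduct * Nat.card (W.selmerGroupPInfty p))
    (hAFE : ∀ D : SignedSelmerDualData W κ γ ε, Ideal.map (IwasawaAlgebra.invol p) D.charIdeal = D.charIdeal)
    (hμ : ∀ (D : SignedSelmerDualData W κ γ ε) (ξ : IwasawaAlgebra p), D.charIdeal = Ideal.span {ξ} → mu ξ = 0)
    (D : SignedSelmerDualData W κ γ ε) :
    ∃ (g h : IwasawaAlgebra p) (m : ℕ), D.charIdeal = Ideal.span {g} ∧
      iwasawaToPowerSeries p (PowerSeries.C ((p : ℤ_[p]) ^ m) * g) =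
        PowerSeries.C (ϖ : ℚ_[p]) * iwasawaToPowerSeries p (kobayashiL ε Lplus Lminus * h) := by
  have hϖ0 : ϖ ≠ 0 := by
    rintro rfl
    rw [Rat.cast_zero, zero_mul] at hϖ
    exact (IsNewform0.plusPeriod_pos_holds hf.1 hf.coeffField_eq_bot).ne' hϖ.symm
  have hKato := exists_C_pow_mul_mem_charIdeal h12 h41 hp hgood hap hf hκ hγ hγ'
    (hPP.isSignedPAdicLFunction_kobayashiL ε) D
  exact (lambdaShape_iff_forall_lam_le D hϖ0 (IsPollackPair.kobayashiL_ne_zero p hPP ε) hKato).mpr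
    fun ξ hξ ↦ lam_le_lam_charGen_of_afe_of_lam_le_two h12 hK13 hp hgood hap hκ hγ D hξ (hAFE D) hfin hdvd
      (hμ D ξ hξ) hL2

/-- **NECESSITY of the `T = 0` shadow.** Same frame, granted `h12`, `hK13`: if `Sel_{p^∞}(E/ℚ)` is finite and the
λ-inequality `lam L ≤ lam ξ` holds for some `L` with `lam L ≥ 1`, then `p ∣ ∏_ℓ c_ℓ · #Sel_{p^∞}(E/ℚ)` (`λ(ξ) ≥ 1` makes
the `p`-free part of `ξ` a non-unit, so `p ∣ ξ(0) = u · p^{ord_p Tam} · #Sel`). READING: at a rank-`0` pair with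
`λ(L_3^ε) ≥ 1` the stub DEMANDS `3 ∣ Tam(E)·#Sel_{3^∞}(E/ℚ)` — the converse divisibility at `T = 0`, i.e. the rank-`0`
`3`-part-of-BSD LOWER bound (decidable per pair: Tamagawa numbers, else `Sel_3(E/ℚ) ≠ 0` by descent).
[cite: BDKim2013, Cor. 3.15 (p. 199)] [cite: Kobayashi2003, Thm. 1.2 and Conjecture (p. 2)] [cite: Washington1997, §7.1] -/
theorem dvd_tamagawa_mul_card_selmer_of_lam_pos_of_lamLe
    (h12 : Kobayashi2003.thm12_signedSelmerDual_finite_torsion)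
    (hK13 : BDKim2013.cor315_signedCharValue_rankZero) (hp : p ≠ 2) (hgood : W.HasGoodReductionAtPrime p)
    (hap : W.frobeniusTrace p = 0) (hκ : κ.IsCyclotomic) (hγ : κ.IsTopGenerator γ)
    (D : SignedSelmerDualData W κ γ ε) {ξ : IwasawaAlgebra p} (hξ : D.charIdeal = Ideal.span {ξ})
    (hfin : Finite (W.selmerGroupPInfty p)) {L : IwasawaAlgebra p} (hL1 : 1 ≤ lam L) (hle : lam L ≤ lam ξ) :
    p ∣ W.tamagawaProduct * Nat.card (W.selmerGroupPInfty p) := by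
  haveI : Module.Finite (IwasawaAlgebra p) D.X := h12.moduleFinite hp hgood hap hκ hγ D
  have hX : Module.IsTorsion (IwasawaAlgebra p) D.X := h12.isTorsion hp hgood hap hκ hγ D
  -- `p ∣ ξ(0)`: otherwise `ξ(0)`, hence `ξ`, is a unit of `Λ` and `λ(ξ) = 0`
  have hc0 : (p : ℤ_[p]) ∣ constantCoeff ξ := by
    have hnu : ¬ IsUnit (constantCoeff ξ) := fun hu ↦ by
      have h := ((isUnit_iff_mu_eq_zero_and_lam_eq_zero ξ).mp (PowerSeries.isUnit_iff_constantCoeff.mpr hu)).2.2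
      omega
    have hmem : constantCoeff ξ ∈ IsLocalRing.maximalIdeal ℤ_[p] := (IsLocalRing.mem_maximalIdeal _).mpr hnu
    rwa [PadicInt.maximalIdeal_eq_span_p, Ideal.mem_span_singleton] at hmem
  -- compare with Kim's value `ξ(0) = u · p^{ord_p Tam} · #Sel`
  obtain ⟨u, hu⟩ := hK13 W p hp hgood hap κ γ hκ hγ ε D hX ξ hξ hfin
  have hu' : constantCoeff ξ = (u : ℤ_[p]) * (p : ℤ_[p]) ^ padicValNat p W.tamagawaProduct *
      (Nat.card (W.selmerGroupPInfty p) : ℤ_[p]) := by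
    refine PadicInt.ext ?_
    push_cast
    exact hu
  by_contra hnd
  have hv0 : padicValNat p W.tamagawaProduct = 0 :=
    padicValNat.eq_zero_of_not_dvd fun h ↦ hnd (Dvd.dvd.mul_right h _)
  rw [hu', hv0, pow_zero, mul_one] at hc0
  have hcu : (p : ℤ_[p]) ∣ (Nat.card (W.selmerGroupPInfty p) : ℤ_[p]) := (Units.isUnit u).dvd_mul_left.mp hc0
  exact hnd (Dvd.dvd.mul_left
    (PadicInt.norm_natCast_lt_one_iff.mp ((PadicInt.norm_lt_one_iff_dvd _).mpr hcu)) _)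

end Shadow

/-! ## §3. Rank-`0` DEFECT EVENNESS: `λ(L_p^ε) − λ(ξ^ε) ∈ 2ℕ`; the door widened on the algebraic side -/

section Defect

variable {p : ℕ} [Fact p.Prime] {W : WeierstrassCurve ℚ} [W.IsElliptic] [W.IsGloballyMinimal]
  {κ : ZpExtension ℚ p} {γ : absoluteGaloisGroup ℚ} {ε : ℤˣ}

/-- **Rank-`0` DEFECT EVENNESS.** Odd good `p`, `a_p = 0`, cyclotomic frame, newform `f` of level `N_E`, Pollack pair,
dual datum `D` with generator `ξ`, ANY image, ANY `μ`; granted `h12`, `h41` (rational), `hK13`, `hpar`, `hAFE`: if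
`Sel_{p^∞}(E/ℚ)` is finite then `λ(ξ^ε) ≤ λ(L_p^ε)` (Kato) and `λ(L_p^ε) − λ(ξ^ε)` is EVEN (analytic side: g3's μ-free
`w(E) = (−1)^{λ(L_p^ε)}` and `(−1)^{corank} = w(E)` at corank `0`; algebraic side §1). [cite: Kobayashi2003, Thm. 1.2 and Thm. 4.1 (p. 8)]
[cite: KimBD2008MRL, Thm. 3.12 (p. 93)] [cite: BDKim2013, Cor. 3.15 (p. 199)] [cite: DokchitserDokchitserAnnals2010, Thm. 1.4] [cite: Sprung2017, Cor. 4.14] -/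
theorem even_lam_kobayashiL_sub_lam_charGen_of_afe
    (h12 : Kobayashi2003.thm12_signedSelmerDual_finite_torsion)
    (h41 : Kobayashi2003.thm41_signedCharIdeal_divisibility) (hK13 : BDKim2013.cor315_signedCharValue_rankZero)
    (hpar : p_parity W p) (hp : p ≠ 2) (hgood : W.HasGoodReductionAtPrime p) (hap : W.frobeniusTrace p = 0)
    [NeZero (W.conductorNorm ℤ)] {f : CuspForm (Gamma0 (W.conductorNorm ℤ)) 2} (hf : IsNewformOf W f)
    (hκ : κ.IsCyclotomic) (hγ : κ.IsTopGenerator γ) (hγ' : IsCyclotomicVariable p γ)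
    {Lplus Lminus : IwasawaAlgebra p} (hPP : IsPollackPair f p Lplus Lminus)
    (D : SignedSelmerDualData W κ γ ε) {ξ : IwasawaAlgebra p} (hξ : D.charIdeal = Ideal.span {ξ})
    (hAFE : Ideal.map (IwasawaAlgebra.invol p) D.charIdeal = D.charIdeal)
    (hfin : Finite (W.selmerGroupPInfty p)) :
    lam ξ ≤ lam (kobayashiL ε Lplus Lminus) ∧ Even (lam (kobayashiL ε Lplus Lminus) - lam ξ) := by
  -- Kato's rational divisibility `ξ ∣ p^n L_p^ε`
  obtain ⟨n, hn⟩ := exists_C_pow_mul_mem_charIdeal h12 h41 hp hgood hap hf hκ hγ hγ'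
    (hPP.isSignedPAdicLFunction_kobayashiL ε) D
  rw [hξ, Ideal.mem_span_singleton] at hn
  have hle : lam ξ ≤ lam (kobayashiL ε Lplus Lminus) :=
    lam_le_lam_of_dvd_C_pow_mul (IsPollackPair.kobayashiL_ne_zero p hPP ε) hn
  refine ⟨hle, ?_⟩
  -- analytic side: corank `0` ⇒ `w(E) = +1` ⇒ `λ(L_p^ε)` even
  have h0 : W.selmerCorank p = 0 := by
    haveI := hfin
    exact zpCorank_eq_zero_of_finite _ p
  have hL : Even (lam (kobayashiL ε Lplus Lminus)) := by
    rw [even_lam_iff_even_selmerCorank W p hpar hp hgood hap hf hPP ε, h0]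
    exact Even.zero
  -- algebraic side: §1
  have hA : Even (lam ξ) := even_lam_charGen_of_afe_of_finite h12 hK13 hp hgood hap hκ hγ D hξ hAFE hfin
  exact (Nat.even_sub hle).mpr (iff_of_true hL hA)

/-- **The door widened on the ALGEBRAIC side (rank `0`): `λ(L_p^ε) ≤ λ(ξ^ε) + 1` suffices** (a defect of exactly one is
impossible). Compare g3's `lambdaShape_of_lam_le_selmerCorank_add_one` (door `λ(L) ≤ corank + 1`): as `corank ≤ λ(ξ^ε)`
this door is wider whenever `X^ε` has algebraic excess. READING: at a rank-`0` pair the stub's residue is a genuine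
missing PAIR of algebraic zeros, `λ(L_3^ε) ≥ λ(ξ^ε) + 2`. [cite: Kobayashi2003, Thm. 1.2, Thm. 4.1 (p. 8) and Conjecture (p. 2)]
[cite: KimBD2008MRL, Thm. 3.12 (p. 93)] [cite: DokchitserDokchitserAnnals2010, Thm. 1.4] [cite: BDKim2013, Cor. 3.15 (p. 199)] -/
theorem lam_kobayashiL_le_lam_charGen_of_afe_of_le_add_one
    (h12 : Kobayashi2003.thm12_signedSelmerDual_finite_torsion)
    (h41 : Kobayashi2003.thm41_signedCharIdeal_divisibility) (hK13 : BDKim2013.cor315_signedCharValue_rankZero)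
    (hpar : p_parity W p) (hp : p ≠ 2) (hgood : W.HasGoodReductionAtPrime p) (hap : W.frobeniusTrace p = 0)
    [NeZero (W.conductorNorm ℤ)] {f : CuspForm (Gamma0 (W.conductorNorm ℤ)) 2} (hf : IsNewformOf W f)
    (hκ : κ.IsCyclotomic) (hγ : κ.IsTopGenerator γ) (hγ' : IsCyclotomicVariable p γ)
    {Lplus Lminus : IwasawaAlgebra p} (hPP : IsPollackPair f p Lplus Lminus)
    (D : SignedSelmerDualData W κ γ ε) {ξ : IwasawaAlgebra p} (hξ : D.charIdeal = Ideal.span {ξ})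
    (hAFE : Ideal.map (IwasawaAlgebra.invol p) D.charIdeal = D.charIdeal)
    (hfin : Finite (W.selmerGroupPInfty p)) (hle1 : lam (kobayashiL ε Lplus Lminus) ≤ lam ξ + 1) :
    lam (kobayashiL ε Lplus Lminus) ≤ lam ξ := by
  obtain ⟨hle, heven⟩ := even_lam_kobayashiL_sub_lam_charGen_of_afe h12 h41 hK13 hpar hp hgood hap hf hκ hγ hγ'
    hPP D hξ hAFE hfin
  by_contra hlt
  have h1 : lam (kobayashiL ε Lplus Lminus) - lam ξ = 1 := by omega
  rw [h1] at heven
  exact Nat.not_even_one heven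

/-- **The stub's `p`-inverted λ-shape at every datum of sign `ε` from the widened door (rank `0`).** Frame as in
`lambdaShape_of_afe_of_lam_le_two` but with the certificate replaced by «`λ(L_p^ε) ≤ λ(ξ^ε) + 1` for every datum
and generator» and WITHOUT the `μ` / Tamagawa inputs; granted in addition `hpar`. [cite: Kobayashi2003, Thm. 1.2, Thm. 4.1 (p. 8) and Conjecture (p. 2)]
[cite: KimBD2008MRL, Thm. 3.12 (p. 93)] [cite: DokchitserDokchitserAnnals2010, Thm. 1.4] [cite: GreenbergVatsal2000, p. 4] -/
theorem lambdaShape_of_afe_of_le_add_one (h12 : Kobayashi2003.thm12_signedSelmerDual_finite_torsion)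
    (h41 : Kobayashi2003.thm41_signedCharIdeal_divisibility) (hK13 : BDKim2013.cor315_signedCharValue_rankZero)
    (hpar : p_parity W p) (hp : p ≠ 2) (hgood : W.HasGoodReductionAtPrime p) (hap : W.frobeniusTrace p = 0)
    (hκ : κ.IsCyclotomic) (hγ : κ.IsTopGenerator γ) (hγ' : IsCyclotomicVariable p γ) [NeZero (W.conductorNorm ℤ)]
    {f : CuspForm (Gamma0 (W.conductorNorm ℤ)) 2} (hf : IsNewformOf W f) {ϖ : ℚ}
    (hϖ : (ϖ : ℝ) * W.realPeriodRat = plusPeriod f) {Lplus Lminus : IwasawaAlgebra p}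
    (hPP : IsPollackPair f p Lplus Lminus) (hfin : Finite (W.selmerGroupPInfty p))
    (hAFE : ∀ D : SignedSelmerDualData W κ γ ε, Ideal.map (IwasawaAlgebra.invol p) D.charIdeal = D.charIdeal)
    (hle1 : ∀ (D : SignedSelmerDualData W κ γ ε) (ξ : IwasawaAlgebra p), D.charIdeal = Ideal.span {ξ} →
      lam (kobayashiL ε Lplus Lminus) ≤ lam ξ + 1)
    (D : SignedSelmerDualData W κ γ ε) :
    ∃ (g h : IwasawaAlgebra p) (m : ℕ), D.charIdeal = Ideal.span {g} ∧
      iwasawaToPowerSeries p (PowerSeries.C ((p : ℤ_[p]) ^ m) * g) =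
        PowerSeries.C (ϖ : ℚ_[p]) * iwasawaToPowerSeries p (kobayashiL ε Lplus Lminus * h) := by
  have hϖ0 : ϖ ≠ 0 := by
    rintro rfl
    rw [Rat.cast_zero, zero_mul] at hϖ
    exact (IsNewform0.plusPeriod_pos_holds hf.1 hf.coeffField_eq_bot).ne' hϖ.symm
  have hKato := exists_C_pow_mul_mem_charIdeal h12 h41 hp hgood hap hf hκ hγ hγ'
    (hPP.isSignedPAdicLFunction_kobayashiL ε) D
  exact (lambdaShape_iff_forall_lam_le D hϖ0 (IsPollackPair.kobayashiL_ne_zero p hPP ε) hKato).mpr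
    fun ξ hξ ↦ lam_kobayashiL_le_lam_charGen_of_afe_of_le_add_one h12 h41 hK13 hpar hp hgood hap hf hκ hγ hγ' hPP D
      hξ (hAFE D) hfin (hle1 D ξ hξ)

end Defect

/-! ## §4. Sanity: at `p > 3` the displayed functional equation is Kim's named fact (any image) -/

section Sanity

variable {p : ℕ} [Fact p.Prime] {W : WeierstrassCurve ℚ} [W.IsElliptic] [W.IsGloballyMinimal]
  {κ : ZpExtension ℚ p} {γ : absoluteGaloisGroup ℚ}

/-- **At `p > 3` the per-datum hypothesis `hAFE` of §1–§3 is B. D. Kim 2008 Thm. 3.12** (tree named fact, `K = ℚ`, both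
signs, NO image hypothesis), so at `p ≥ 5` this file is print-only modulo the displayed facts; at `p = 3`, `a_3 = 0` it is
the tree's typing request (Lei–Ponsinet 2017 Thm. 1/2 ∘ the Büyükboduk–Lei / Kobayashi identification at `a_p = 0`). The
per-sign `∀ D` shape of slh-p1-w6's `LargeImageLambdaTwoStratum.afe_of_thm312`. [cite: KimBD2008MRL, Thm. 3.12 (p. 93) and §1 p. 83]
[cite: LeiPonsinet2017, §1 and Thm. 1] -/
theorem afe_of_thm312_small (hK08 : Kim2008.thm312_signedSelmerDual_charIdeal_map_invol) (hp3 : 3 < p)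
    (hgood : W.HasGoodReductionAtPrime p) (hap : W.frobeniusTrace p = 0) (hκ : κ.IsCyclotomic)
    (hγ : κ.IsTopGenerator γ) (ε : ℤˣ) :
    ∀ D : SignedSelmerDualData W κ γ ε, Ideal.map (IwasawaAlgebra.invol p) D.charIdeal = D.charIdeal :=
  fun D ↦ hK08 W p hp3 hgood hap κ γ hκ hγ ε D

end Sanity

end Summit.BirchSwinnertonDyer.BirchSwinnertonDyer.Theorems.SmallImageLambdaLowerThreeNsAFE

end
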